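import Mathlib
import Literature.MathematicalPhysics.QuantumFieldTheory.UniformTorusClusteringProofs
import Summits.QuantumFields.YangMills.Theses.InfraredLiouville
import Summits.QuantumFields.YangMills.Theorems.InfraredLiouvilleStrongCouplingIRTrivialCutoff
import Summits.QuantumFields.YangMills.Theorems.InfraredLiouvilleStrongCouplingIRTrivialLatticeSum
import Summits.QuantumFields.YangMills.Theorems.InfraredLiouvilleStrongCouplingIRTrivialTwoPoint
import HarnessLib

/-!
# `StrongCouplingIRTrivial`: infrared limits of strong-coupling lattice Yang–Mills have vanishing
# two-point functions

Route `InfraredLiouville` of `YangMills`, support item `stmt-QuantumFields-9708`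
(`Summit.QuantumFields.YangMills.Theses.InfraredLiouville.StrongCouplingIRTrivial`): for every
compact `G` and faithful unitary lattice representation `r` there is `β_s > 0` such that for
`0 ≤ β < β_s` every infrared scaling limit of Wilson's lattice theory at fixed coupling `β`
(constant-coupling scheme, polynomially bounded renormalisations, exact centring, joint
convergence of all rescaled lattice functions on off-diagonal tensors) has vanishing two-point
functions on off-diagonal tensors.

## Proof

1. (`TwoPoint`) The rescaled lattice two-point function at step `k` is
   `c₀ c₁ a⁸ ∑ₓ ∑_y g₀(a x) g₁(a y) K_k(x, y)`, and exact centring plus translation invariance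
   of the torus state make `K_k(x, y)` the torus truncated correlation at displacement `x − y`.
2. (`Literature…UniformTorusClustering`, `osterwalder_seiler_torusClustering_uniform`, PROVED in
   `UniformTorusClusteringProofs` by the replica expansion of the torus plaquette system and the
   Schwarz lemma) At strong coupling the torus truncated correlations decay exponentially in the
   displacement, uniformly in the volume — Osterwalder–Seiler 1978 Thm. 3.5. (The tree's older
   `osterwalder_seiler_torusClustering` is only the pointwise-in-displacement form `∀ x, ∀ᶠ L`,
   which cannot control a lattice sum over `O(a_k⁻⁴)` displacements on the torus of step `k`.)
3. (`LatticeSum`, `flat_bound`) For COMPACTLY supported factors `gᵢ` (support radius `R₀`),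
   flatness of the off-diagonal tensor `g₀ ⊗ g₁` at the diagonal
   (`IsOffDiagonal.norm_le_seminorm_mul_pow_sub`, order `p₀ + p₁ + 1`) beats the polynomial
   renormalisations: `|lattice_k| ≤ D a_k` once `a_k ≤ 1` and `a_k L_k ≥ 2R₀` (then all
   contributing displacements are at most half the period), so `lattice_k → 0` and the limit
   `𝔖₂(g₀ ⊗ g₁)` vanishes.
4. (`Cutoff`) A general off-diagonal tensor `F = f₀ ⊗ f₁` is the Schwartz limit of the cut-off
   tensors `(χ_R f₀) ⊗ (χ_R f₁)` (still off-diagonal tensors, so step 3 applies to them), and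
   `𝔖₂` is continuous: `𝔖₂(F) = lim 0 = 0`. (A direct estimate of `lattice_k(F)` is impossible:
   sites near opposite faces of the fundamental domain are torus neighbours, and the Schwartz tails
   of `f₀`, `f₁` weighted by `cᵢ ∼ a⁻ᵖ` need not be small there.)
-/

noncomputable section

open scoped SchwartzMap BigOperators Topology
open MeasureTheory Filter Finset
open Literature.MathematicalPhysics.QuantumFieldTheory Literature.MathematicalPhysics.QuantumLattice
  Literature.MathematicalPhysics.AQFT
open Literature.Probability.LatticeModels (Site box mem_box card_box mem_box_iff_supNorm_le
  Site.norm_eq_supNorm)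

namespace Summit.QuantumFields.YangMills.Theorems.StrongCouplingIRTrivial

/-! ### Geometry of the embedding `ℤ⁴ ↪ ℝ⁴` -/

/-- Euclidean versus sup norm on `ℤ⁴`: `‖siteToE z‖ ≤ 2 ‖z‖_∞`. [folklore] -/
theorem norm_siteToE_le (z : Site 4) : ‖siteToE z‖ ≤ 2 * ‖z‖ := by
  rw [EuclideanSpace.norm_eq]
  have h : ∑ i, ‖(siteToE z).ofLp i‖ ^ 2 ≤ (2 * ‖z‖) ^ 2 := by
    calc ∑ i : Fin 4, ‖(siteToE z).ofLp i‖ ^ 2 ≤ ∑ _i : Fin 4, ‖z‖ ^ 2 :=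
          Finset.sum_le_sum fun i _ => by
            rw [show (siteToE z).ofLp i = (z i : ℝ) from rfl, Real.norm_eq_abs]
            exact pow_le_pow_left₀ (abs_nonneg _) (LatticeSum.abs_cast_apply_le_norm z i) 2
      _ = (2 * ‖z‖) ^ 2 := by simp; ring
  calc √(∑ i, ‖(siteToE z).ofLp i‖ ^ 2) ≤ √((2 * ‖z‖) ^ 2) := Real.sqrt_le_sqrt h
    _ = 2 * ‖z‖ := Real.sqrt_sq (by positivity)

/-- `siteToE` is additive: `siteToE (x − y) = siteToE x − siteToE y`. [folklore] -/
theorem siteToE_sub (x y : Site 4) : siteToE (x - y) = siteToE x - siteToE y := by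
  ext i
  simp [siteToE_apply]

/-- A site whose rescaled position lies in the ball of radius `R₀` lies in the cube
`box 4 ⌊R₀ / a⌋₊`. [folklore] -/
theorem mem_box_of_norm_smul_le {a R₀ : ℝ} (ha : 0 < a) {x : Site 4}
    (h : ‖a • siteToE x‖ ≤ R₀) : x ∈ box 4 ⌊R₀ / a⌋₊ := by
  rw [norm_smul, Real.norm_eq_abs, abs_of_pos ha, ← le_div_iff₀' ha] at h
  rw [mem_box]
  intro i
  have hi : |(x i : ℝ)| ≤ R₀ / a := by
    have h1 : ‖(siteToE x).ofLp i‖ ≤ ‖siteToE x‖ := PiLp.norm_apply_le (siteToE x) i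
    rw [show (siteToE x).ofLp i = (x i : ℝ) from rfl, Real.norm_eq_abs] at h1
    exact h1.trans h
  have hn : (x i).natAbs ≤ ⌊R₀ / a⌋₊ := by
    refine Nat.le_floor ?_
    rw [Nat.cast_natAbs, Int.cast_abs]
    exact hi
  omega

/-- Sites of `box 4 N` have sup norm at most `N`. [folklore] -/
theorem norm_le_of_mem_box {N : ℕ} {x : Site 4} (hx : x ∈ box 4 N) : ‖x‖ ≤ N := by
  rw [Site.norm_eq_supNorm]
  exact_mod_cast mem_box_iff_supNorm_le.1 hx

/-! ### Flatness of the off-diagonal tensor on the lattice -/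

/-- **Flatness at the diagonal, on lattice points.** For an off-diagonal tensor `G = g₀ ⊗ g₁`
and every order `M`: `|g₀(a x)| |g₁(a y)| ≤ (‖G‖_{0,M+1} 2^{M+1}/M!) (a ‖x − y‖_∞)^{M+1}`
(tree `IsOffDiagonal.norm_le_seminorm_mul_pow_sub`). [folklore] -/
theorem flat_bound {g : Fin 2 → 𝓢(EuclideanSpace ℝ (Fin 4), ℝ)}
    {Gt : 𝓢((Fin 2 → EuclideanSpace ℝ (Fin 4)), ℂ)}
    (hG : IsTensorOf Gt fun i => ofRealTest (g i)) (hO : IsOffDiagonal Gt) (M : ℕ) {a : ℝ}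
    (ha : 0 ≤ a) (x y : Site 4) :
    |g 0 (a • siteToE x)| * |g 1 (a • siteToE y)| ≤
      (SchwartzMap.seminorm ℂ 0 (M + 1) Gt * 2 ^ (M + 1) / M.factorial) *
        (a * ‖x - y‖) ^ (M + 1) := by
  set v : Fin 2 → EuclideanSpace ℝ (Fin 4) := ![a • siteToE x, a • siteToE y] with hv
  have h := hO.norm_le_seminorm_mul_pow_sub (a := 0) (b := 1) (by decide) v M
  have hGv : ‖Gt v‖ = |g 0 (a • siteToE x)| * |g 1 (a • siteToE y)| := by
    rw [hG v, Fin.prod_univ_two, norm_mul]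
    simp [hv, Complex.norm_real]
  have hdist : ‖v 1 - v 0‖ ≤ 2 * (a * ‖x - y‖) := by
    simp only [hv, Matrix.cons_val_one, Matrix.cons_val_zero]
    rw [← smul_sub, norm_smul, Real.norm_eq_abs, abs_of_nonneg ha, ← siteToE_sub]
    calc a * ‖siteToE (y - x)‖ ≤ a * (2 * ‖y - x‖) :=
          mul_le_mul_of_nonneg_left (norm_siteToE_le _) ha
      _ = 2 * (a * ‖x - y‖) := by rw [norm_sub_rev]; ring
  have hp : 0 ≤ SchwartzMap.seminorm ℂ 0 (M + 1) Gt := apply_nonneg _ _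
  rw [← hGv]
  calc ‖Gt v‖ ≤ SchwartzMap.seminorm ℂ 0 (M + 1) Gt * ‖v 1 - v 0‖ ^ (M + 1) / M.factorial := h
    _ ≤ SchwartzMap.seminorm ℂ 0 (M + 1) Gt * (2 * (a * ‖x - y‖)) ^ (M + 1) / M.factorial := by
        gcongr
    _ = _ := by rw [mul_pow]; ring

/-! ### The lattice two-point functions of compactly supported tensors tend to zero -/

variable {G : Type} [Group G] [TopologicalSpace G] [IsTopologicalGroup G] [CompactSpace G]
  [MeasurableSpace G] [BorelSpace G]

/-- **Main estimate.** At a coupling where the torus truncated correlations of the two species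
cluster uniformly (displacements of at most half the period), the rescaled lattice two-point
function of a compactly supported off-diagonal tensor is `O(a_k)`, hence tends to `0`.
[folklore] -/
theorem tendsto_latticeSchwinger_two (r : LatticeRep G) (sch : SpeciesScheme (YMSpecies G))
    {β : ℝ} (hβ : ∀ k, sch.β k = β)
    (hc : ∀ s : YMSpecies G, ∃ (p : ℕ) (K : ℝ), ∀ k : ℕ, |sch.c s k| ≤ K * (sch.a k)⁻¹ ^ p)
    (hm : ∀ (s : YMSpecies G) (k : ℕ), sch.m s k = ∫ U, s.F (torusLift (sch.side k) U)
      ∂(wilsonMeasure (d := 4) (L := sch.side k) r.ρ (sch.β k)))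
    {m C : ℝ} (hm0 : 0 < m) (σ : Fin 2 → YMSpecies G)
    (hcl : ∀ (L : ℕ) (z : Site 4), 2 * ‖z‖ < (L : ℝ) + 1 →
      |wilsonExpectation (L := L + 1) r.ρ β
            (toTorusObservable (L + 1) fun U => (σ 0).F U * (σ 1).F (configShift z U)) -
          wilsonExpectation (L := L + 1) r.ρ β (toTorusObservable (L + 1) (σ 0).F) *
            wilsonExpectation (L := L + 1) r.ρ β
              (toTorusObservable (L + 1) ((σ 1).F ∘ configShift z))| ≤
        C * Real.exp (-m * ‖z‖))
    (g : Fin 2 → 𝓢(EuclideanSpace ℝ (Fin 4), ℝ)) {Gt : 𝓢((Fin 2 → EuclideanSpace ℝ (Fin 4)), ℂ)}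
    (hG : IsTensorOf Gt fun i => ofRealTest (g i)) (hO : IsOffDiagonal Gt)
    {R₀ : ℝ} (hR₀ : 0 ≤ R₀) (hsupp : ∀ i x, g i x ≠ 0 → ‖x‖ ≤ R₀) :
    Tendsto (fun k : ℕ => ((latticeSchwinger r.ρ sch (fun s => s.F) k 2 σ g : ℝ) : ℂ))
      atTop (𝓝 0) := by
  obtain ⟨p₀, K₀, hK₀⟩ := hc (σ 0)
  obtain ⟨p₁, K₁, hK₁⟩ := hc (σ 1)
  set M : ℕ := p₀ + p₁ with hM
  set Φ : ℝ := SchwartzMap.seminorm ℂ 0 (M + 1) Gt * 2 ^ (M + 1) / M.factorial with hΦ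
  have hp0 : 0 ≤ SchwartzMap.seminorm ℂ 0 (M + 1) Gt := apply_nonneg _ _
  have hΦ0 : 0 ≤ Φ := by rw [hΦ]; positivity
  have ha0 : ∀ k, 0 < sch.a k := sch.a_pos
  have hK₀0 : 0 ≤ K₀ := nonneg_of_mul_nonneg_left ((abs_nonneg _).trans (hK₀ 0)) (by
    have := ha0 0; positivity)
  have hK₁0 : 0 ≤ K₁ := nonneg_of_mul_nonneg_left ((abs_nonneg _).trans (hK₁ 0)) (by
    have := ha0 0; positivity)
  have hC0 : 0 ≤ C := by
    have h := (abs_nonneg _).trans (hcl 0 0 (by simp))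
    simpa using h
  set W : ℝ := LatticeSum.weightConst 4 m M with hW
  set D : ℝ := K₀ * K₁ * (2 * R₀ + 1) ^ 4 * (Φ * C * W) with hD
  -- eventually `a_k ≤ 1` and `a_k L_k ≥ 2 R₀`
  have hev : ∀ᶠ k in atTop, sch.a k ≤ 1 ∧ 2 * R₀ ≤ sch.a k * sch.L k :=
    ((sch.tendsto_a.eventually (gt_mem_nhds one_pos)).mono fun k hk => hk.le).and
      (sch.tendsto_L.eventually_ge_atTop (2 * R₀))
  -- the bound `|lattice_k| ≤ D a_k` for such `k`
  have hbound : ∀ k, sch.a k ≤ 1 → 2 * R₀ ≤ sch.a k * sch.L k →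
      |latticeSchwinger r.ρ sch (fun s => s.F) k 2 σ g| ≤ D * sch.a k := by
    intro k hk1 hk2
    have ha := ha0 k
    set a := sch.a k with hadef
    set Nk : ℕ := ⌊R₀ / a⌋₊ with hNk
    -- the kernel and its clustering bound
    set Kf : Site 4 → Site 4 → ℝ := fun x y => TwoPoint.centredKernel r.ρ (sch.β k) (sch.side k)
      (σ 0).F (σ 1).F (sch.m (σ 0) k) (sch.m (σ 1) k) x y with hKf
    have hsuppbox : ∀ i (x : Site 4), g i (a • siteToE x) ≠ 0 → x ∈ box 4 Nk :=
      fun i x hx => mem_box_of_norm_smul_le ha (hsupp i _ hx)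
    have hKbound : ∀ x y : Site 4, g 0 (a • siteToE x) ≠ 0 → g 1 (a • siteToE y) ≠ 0 →
        |Kf x y| ≤ C * Real.exp (-(m * ‖x - y‖)) := by
      intro x y hx hy
      have hxN := norm_le_of_mem_box (hsuppbox 0 x hx)
      have hyN := norm_le_of_mem_box (hsuppbox 1 y hy)
      have hNa : (Nk : ℝ) ≤ R₀ / a := Nat.floor_le (div_nonneg hR₀ ha.le)
      have hxy : ‖x - y‖ ≤ sch.L k := by
        have h1 : ‖x - y‖ ≤ ‖x‖ + ‖y‖ := norm_sub_le x y
        have h2 : 2 * (R₀ / a) ≤ sch.L k := by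
          rw [mul_div_assoc', div_le_iff₀ ha]; linarith [hk2]
        linarith
      have e : Kf x y = TwoPoint.centredKernel r.ρ β (2 * sch.L k + 1) (σ 0).F (σ 1).F
          (sch.m (σ 0) k) (sch.m (σ 1) k) x y := by
        rw [hKf]
        simp only [hβ k]
        rfl
      rw [e]
      refine TwoPoint.abs_centredKernel_le r.ρ r.continuous (σ 0).measurable (σ 1).measurable
        (σ 0).bounded (σ 1).bounded hcl (sch.L k) ?_ ?_ hxy
      · have h := hm (σ 0) k; rw [hβ k] at h; exact h
      · have h := hm (σ 1) k; rw [hβ k] at h; exact h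
    have hsum := LatticeSum.abs_sum_sum_le (d := 4) (by norm_num) (sch.L k) Nk
      (fun x => g 0 (a • siteToE x)) (fun y => g 1 (a • siteToE y)) Kf hm0 ha.le hΦ0 hC0
      (fun x y => flat_bound hG hO M ha.le x y) (hsuppbox 0) hKbound
    -- assemble
    rw [TwoPoint.latticeSchwinger_two_eq r.ρ r.continuous sch (fun s => s.F) k σ g
      (fun i => (σ i).measurable) (fun i => (σ i).bounded)]
    rw [abs_mul, abs_mul, abs_mul, abs_of_pos (pow_pos ha 8)]
    have hcard : (#(box 4 Nk) : ℝ) ≤ ((2 * R₀ + 1) * a⁻¹) ^ 4 := by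
      rw [card_box]
      push_cast
      refine pow_le_pow_left₀ (by positivity) ?_ 4
      have hNa : (Nk : ℝ) ≤ R₀ / a := Nat.floor_le (div_nonneg hR₀ ha.le)
      have h1a : 1 ≤ a⁻¹ := one_le_inv_iff₀.2 ⟨ha, hk1⟩
      calc 2 * (Nk : ℝ) + 1 ≤ 2 * (R₀ / a) + 1 * a⁻¹ := by nlinarith
        _ = (2 * R₀ + 1) * a⁻¹ := by ring
    calc |sch.c (σ 0) k| * |sch.c (σ 1) k| * a ^ 8 *
          |∑ x ∈ box 4 (sch.L k), ∑ y ∈ box 4 (sch.L k),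
            g 0 (a • siteToE x) * g 1 (a • siteToE y) * Kf x y|
        ≤ (K₀ * a⁻¹ ^ p₀) * (K₁ * a⁻¹ ^ p₁) * a ^ 8 *
            (#(box 4 Nk) * (Φ * a ^ (M + 1) * C * W)) := by
          have hcc : |sch.c (σ 0) k| * |sch.c (σ 1) k| ≤ (K₀ * a⁻¹ ^ p₀) * (K₁ * a⁻¹ ^ p₁) :=
            mul_le_mul (hK₀ k) (hK₁ k) (abs_nonneg _) (by positivity)
          exact mul_le_mul (mul_le_mul_of_nonneg_right hcc (pow_pos ha 8).le) hsum
            (abs_nonneg _) (by positivity)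
      _ ≤ (K₀ * a⁻¹ ^ p₀) * (K₁ * a⁻¹ ^ p₁) * a ^ 8 *
            (((2 * R₀ + 1) * a⁻¹) ^ 4 * (Φ * a ^ (M + 1) * C * W)) := by
          have hW0 : 0 ≤ W := LatticeSum.weightConst_nonneg (by norm_num) hm0 M
          gcongr
      _ = D * (a⁻¹ ^ p₀ * a⁻¹ ^ p₁ * a ^ 8 * a⁻¹ ^ 4 * a ^ (M + 1)) := by rw [hD]; ring
      _ = D * a ^ 5 := by
          congr 1
          rw [hM, inv_pow, inv_pow, inv_pow]
          field_simp
          ring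
      _ ≤ D * a := by
          have hD0 : 0 ≤ D := by
            rw [hD]
            have hW0 : 0 ≤ W := LatticeSum.weightConst_nonneg (by norm_num) hm0 M
            positivity
          exact mul_le_mul_of_nonneg_left (pow_le_of_le_one ha.le hk1 (by norm_num)) hD0
  -- conclude
  have hlim : Tendsto (fun k => D * sch.a k) atTop (𝓝 0) := by
    simpa using sch.tendsto_a.const_mul D
  refine squeeze_zero_norm' (hev.mono fun k hk => ?_) hlim
  rw [Complex.norm_real, Real.norm_eq_abs]
  exact hbound k hk.1 hk.2

/-! ### The theorem -/

/-- **`StrongCouplingIRTrivial` from uniform torus clustering at strong coupling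
(`osterwalder_seiler_torusClustering_uniform`, Osterwalder–Seiler 1978 Thm. 3.5).** For every
compact `G` with a faithful unitary lattice representation `r` (so `G` is compact metrisable),
with `β_s := β₀(G, r.ρ, 4)` of the clustering theorem: for `0 ≤ β < β_s`, every constant-coupling
scheme with polynomially bounded renormalisations and exact centring, and every labelled family
`S` to which all joint rescaled lattice functions converge on off-diagonal tensors, has
`S 2 σ F = 0` for all off-diagonal tensors `F = f₀ ⊗ f₁` — cut-off tensors have lattice limit `0`
(`tendsto_latticeSchwinger_two`), they converge to `F` in `𝓢` (`tendsto_cutoffTensor`), and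
`S 2 σ` is continuous. [folklore] -/
theorem strongCouplingIRTrivial_of_torusClusteringUniform
    (hX : osterwalder_seiler_torusClustering_uniform) :
    Summit.QuantumFields.YangMills.Theses.InfraredLiouville.StrongCouplingIRTrivial := by
  intro G _ _ _ _ _ _ r
  haveI : T2Space G := (r.continuous.isClosedEmbedding r.injective).isEmbedding.t2Space
  haveI : SecondCountableTopology G :=
    (r.continuous.isClosedEmbedding r.injective).isEmbedding.secondCountableTopology
  obtain ⟨β₀, hβ₀, hcl⟩ := hX 4 r.N G r.ρ (by norm_num) r.continuous
  refine ⟨β₀, hβ₀, ?_⟩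
  intro β hβ hβ' sch S hschβ hc hm hconv σ f F hF hO
  obtain ⟨m, hm0, hclm⟩ := hcl β hβ hβ'
  obtain ⟨C, hC⟩ := hclm (σ 0).F (σ 1).F ⟨_, (σ 0).isCylinder⟩ ⟨_, (σ 1).isCylinder⟩
    (σ 0).measurable (σ 1).measurable (σ 0).bounded (σ 1).bounded
  -- every cut-off tensor has vanishing two-point function
  have hcut : ∀ R : ℝ, 0 < R → S 2 σ (cutoffTensor R f) = 0 := by
    intro R hR
    have hlim := hconv 2 two_ne_zero σ (fun i => cutoffTest R (f i)) (cutoffTensor R f)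
      (isTensorOf_cutoffTensor R f) (isOffDiagonal_cutoffTensor hO hF R)
    refine tendsto_nhds_unique hlim ?_
    exact tendsto_latticeSchwinger_two r sch hschβ hc hm hm0 σ hC (fun i => cutoffTest R (f i))
      (isTensorOf_cutoffTensor R f) (isOffDiagonal_cutoffTensor hO hF R) (R₀ := 2 * R)
      (by positivity) fun i x hx => norm_le_of_cutoffTest_ne_zero hR hx
  -- pass to the limit `R → ∞` by continuity of `S 2 σ`
  have h1 : Tendsto (fun j : ℕ => S 2 σ (cutoffTensor ((j : ℝ) + 1) f)) atTop (𝓝 (S 2 σ F)) :=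
    ((S 2 σ).continuous.tendsto F).comp (tendsto_cutoffTensor hF)
  have h2 : (fun j : ℕ => S 2 σ (cutoffTensor ((j : ℝ) + 1) f)) = fun _ => 0 :=
    funext fun j => hcut _ (by positivity)
  rw [h2] at h1
  exact (tendsto_nhds_unique tendsto_const_nhds h1).symm

/-- **`StrongCouplingIRTrivial` holds** (item `stmt-QuantumFields-9708` of route
`InfraredLiouville`): the strong-coupling calibration of the infrared-limit class — every
infrared scaling limit of Wilson's lattice theory at small fixed `β` has vanishing two-point
functions on off-diagonal tensors. Unconditional: the uniform torus clustering is the proved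
`osterwalder_seiler_torusClustering_uniform_holds`. [folklore] -/
theorem strongCouplingIRTrivial_proof :
    Summit.QuantumFields.YangMills.Theses.InfraredLiouville.StrongCouplingIRTrivial :=
  strongCouplingIRTrivial_of_torusClusteringUniform
    Literature.MathematicalPhysics.QuantumFieldTheory.osterwalder_seiler_torusClustering_uniform_holds

end Summit.QuantumFields.YangMills.Theorems.StrongCouplingIRTrivial

end
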